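import Summits.Ventures.CertifiedQuantumChemistry.Rows.SingletRows
import Summits.Ventures.CertifiedQuantumChemistry.Rows.LowerCertificateCompleteness
import Literature.LinearAlgebra.Matrix.MoorePenroseInverse
import Literature.MathematicalPhysics.QuantumLattice.FinDimSpectrumSectorGibbsLimit
import Literature.MathematicalPhysics.QuantumLattice.SectorEigenvalueContinuation
import Literature.MathematicalPhysics.QuantumLattice.HubbardWave0RepulsiveProofs
import Literature.MathematicalPhysics.QuantumLattice.HubbardSzSectorLadder
import Literature.MathematicalPhysics.QuantumLattice.FermionOperatorsSpinHermitianProofs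
import HarnessLib

/-!
# Ventures/CertifiedQuantumChemistry — Rows/SingletLowerCertificateCompleteness.lean: the SINGLET LOWER predicate is complete

HONEST FRAMING (verbatim): certified bounds for a stated model Hamiltonian in a stated basis; not a
claim about the real molecule beyond that model.

var-2 (gen 21), zero compute; theorems only (no `def`, no claim node, no model, NO BOUND ASSERTED). The
companion of the typer's `Rows/LowerCertificateCompleteness.lean` for the SINGLET-RESTRICTED predicate of
`Rows/SingletRows.lean`:

* `singletLowerCertificate_of_singletLowerRow` — for a symmetric model, EVERY true singlet lower row
  `SingletLowerRow F n lo` (`lo ≤ E₀(H_F; N = 2n, S = 0)`) has a certificate of the exact shape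
  `SingletLowerCertificate F n lo` (PSD Gram part + two-sided multipliers of the sector ideals `N̂_↑ − n`,
  `N̂_↓ − n` + ONE two-sided multiplier pair of the ideal generated by `Ŝ₋Ŝ₊`; no commutator rows, no charged
  words, no residual, `c = lo`);
* `singletLowerCertificate_iff_singletLowerRow` — hence the singlet claim nodes of `Certificates/` are, as
  propositions, exactly the singlet rows they carry (on the physical range).

CONSEQUENCE FOR THE CELL. A kernel-proved `SingletLowerRow` (the «SP SINGLET KERNEL LOWER» replay files,
`Rows/SOSDualSinglet.lean`) DISCHARGES the corresponding claim node `cert_… : SingletLowerCertificate …` by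
this theorem, exactly as `lowerCertificate_of_lowerRow` does on the sector side.

PROOF (finite-dimensional linear algebra). Let `A = H_F − lo·1`, `P` the diagonal projector onto the `(n, n)`
occupation sector, `B = Ŝ₊ P`, and `Π = 1 − B⁺B` (`B⁺` the Moore–Penrose inverse,
`Literature/LinearAlgebra/Matrix/MoorePenroseInverse.lean`): `Π` is the Hermitian projector onto `ker B`, so
`Ŝ₊ (P Π x) = B Π x = 0` and `P Π x` is a singlet of the sector, whence `(PΠ)ᴴ A (PΠ) ⪰ 0` by the singlet
variational principle (`minEnergyOn_le_rayleigh_of_mem`) and the row's `lo ≤ E₀(S = 0)`. Next,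
`B⁺B = (BᴴB)⁺(BᴴB)` and `BᴴB = P Ŝ₋Ŝ₊ P = P·Ŝ₋Ŝ₊` because `Ŝ₋Ŝ₊` COMMUTES with the sector projector (it commutes
with the diagonal `N̂` and `Ŝ_z`, hence its nonzero entries join configurations with equal `(N_↑, N_↓)`); with
`Z = (BᴴB)⁺` (Hermitian) this gives `1 − Π = Z P·Ŝ₋Ŝ₊ = Ŝ₋Ŝ₊·P Z`, and therefore
`P A P = Π(PAP)Π + (PAPZP)·Ŝ₋Ŝ₊ + Ŝ₋Ŝ₊·(PZ(PAP)Π)`.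
Finally `A = PAP + A(1 − P) + (1 − P)AP` with `1 − P` in the number ideals exactly as in the sector proof
(`pinv_identity`), and every square matrix is a `gramForm` (`gramForm_submatrix_single`).
-/

noncomputable section

namespace Summit.Ventures.CertifiedQuantumChemistry

open Matrix Finset
open Literature.MathematicalPhysics.QuantumLattice Literature.MathematicalPhysics.QuantumChemistry
open Literature.LinearAlgebra.Matrix.MoorePenrose
open scoped ComplexOrder

variable {k : ℕ}

/-! ## Two generic facts about commuting with a diagonal matrix -/

/-- A matrix commuting with `diagonal d` has zero entries between indices with different `d`. -/
theorem apply_eq_zero_of_diagonal_mul_eq_mul_diagonal {ι : Type*} [Fintype ι] [DecidableEq ι]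
    {d : ι → ℂ} {M : Matrix ι ι ℂ} (h : diagonal d * M = M * diagonal d) {s t : ι} (hst : d s ≠ d t) :
    M s t = 0 := by
  have e := congrFun (congrFun h s) t
  rw [diagonal_mul, mul_diagonal] at e
  have e' : (d s - d t) * M s t = 0 := by rw [sub_mul, e]; ring
  rcases mul_eq_zero.1 e' with h0 | h0
  · exact absurd (sub_eq_zero.1 h0) hst
  · exact h0

/-- A matrix whose nonzero entries join indices with equal `p` commutes with `diagonal p`. -/
theorem diagonal_mul_eq_mul_diagonal_of_apply {ι : Type*} [Fintype ι] [DecidableEq ι]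
    {p : ι → ℂ} {M : Matrix ι ι ℂ} (h : ∀ s t, M s t ≠ 0 → p s = p t) :
    diagonal p * M = M * diagonal p := by
  ext s t
  rw [diagonal_mul, mul_diagonal]
  by_cases h0 : M s t = 0
  · rw [h0, mul_zero, zero_mul]
  · rw [h s t h0, mul_comm]

/-! ## `Ŝ₋Ŝ₊` commutes with `N̂`, `Ŝ_z`, and with the sector projector -/

/-- `N̂ (Ŝ₋Ŝ₊) = (Ŝ₋Ŝ₊) N̂`. -/
theorem totalNumber_mul_spinMinus_mul_spinPlus :
    (totalNumber : Op k) * (spinMinus * spinPlus) = spinMinus * spinPlus * totalNumber := by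
  rw [← Matrix.mul_assoc, LiebTwo.totalNumber_mul_spinMinus, Matrix.mul_assoc, LiebTwo.totalNumber_mul_spinPlus,
    ← Matrix.mul_assoc]

/-- `Ŝ_z (Ŝ₋Ŝ₊) = (Ŝ₋Ŝ₊) Ŝ_z` (from `[Ŝ_z, Ŝ₊] = Ŝ₊` and its adjoint `[Ŝ_z, Ŝ₋] = −Ŝ₋`). -/
theorem spinZ_mul_spinMinus_mul_spinPlus :
    (HubbardWave0.spinZ : Op k) * (spinMinus * spinPlus) = spinMinus * spinPlus * HubbardWave0.spinZ := by
  have hp : (HubbardWave0.spinZ : Op k) * spinPlus = spinPlus + spinPlus * HubbardWave0.spinZ :=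
    sub_eq_iff_eq_add.1 LiebTwo.spinZ_mul_spinPlus_sub
  have hm : (HubbardWave0.spinZ : Op k) * spinMinus = spinMinus * HubbardWave0.spinZ - spinMinus := by
    have h := congrArg conjTranspose (LiebTwo.spinZ_mul_spinPlus_sub (Λ := Fin k))
    rw [conjTranspose_sub, conjTranspose_mul, conjTranspose_mul, HubbardWave0.spinZ_isHermitian.eq] at h
    -- h : spinPlusᴴ * spinZ - spinZ * spinPlusᴴ = spinPlusᴴ
    change spinMinus * HubbardWave0.spinZ - HubbardWave0.spinZ * spinMinus = spinMinus at h
    rw [sub_eq_iff_eq_add.1 h]; abel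
  rw [← Matrix.mul_assoc, hm, Matrix.sub_mul, Matrix.mul_assoc, hp, Matrix.mul_add, ← Matrix.mul_assoc]
  abel

/-- A nonzero entry of `Ŝ₋Ŝ₊` joins configurations with the same `(N_↑, N_↓)`. -/
theorem upPart_downPart_eq_of_spinMinus_mul_spinPlus_apply_ne_zero {s t : Finset (Orb (Fin k))}
    (h : (spinMinus * spinPlus : Op k) s t ≠ 0) :
    (upPart s).card = (upPart t).card ∧ (downPart s).card = (downPart t).card := by
  have hN : diagonal (fun s : Finset (Orb (Fin k)) => (s.card : ℂ)) * (spinMinus * spinPlus : Op k) =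
      (spinMinus * spinPlus : Op k) * diagonal (fun s : Finset (Orb (Fin k)) => (s.card : ℂ)) := by
    have e := totalNumber_mul_spinMinus_mul_spinPlus (k := k)
    rwa [← totalNumberOp_eq_totalNumber, totalNumberOp_eq_diagonal] at e
  have hZ : diagonal (fun s : Finset (Orb (Fin k)) => (1 / 2 : ℂ) * (((upPart s).card : ℂ) - ((downPart s).card : ℂ))) *
      (spinMinus * spinPlus : Op k) = (spinMinus * spinPlus : Op k) *
      diagonal (fun s : Finset (Orb (Fin k)) => (1 / 2 : ℂ) * (((upPart s).card : ℂ) - ((downPart s).card : ℂ))) := by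
    have e := spinZ_mul_spinMinus_mul_spinPlus (k := k)
    rwa [LiebThm1.spinZ_eq_diagonal] at e
  have h1 : (s.card : ℂ) = t.card := by
    by_contra hne; exact h (apply_eq_zero_of_diagonal_mul_eq_mul_diagonal hN hne)
  have h2 : (1 / 2 : ℂ) * (((upPart s).card : ℂ) - ((downPart s).card : ℂ)) =
      (1 / 2 : ℂ) * (((upPart t).card : ℂ) - ((downPart t).card : ℂ)) := by
    by_contra hne; exact h (apply_eq_zero_of_diagonal_mul_eq_mul_diagonal hZ hne)
  rw [card_eq_upPart_add_downPart s, card_eq_upPart_add_downPart t] at h1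
  push_cast at h1
  have h2' : ((upPart s).card : ℂ) - ((downPart s).card : ℂ) = ((upPart t).card : ℂ) - ((downPart t).card : ℂ) :=
    mul_left_cancel₀ (by norm_num) h2
  have hu : ((upPart s).card : ℂ) = (upPart t).card := by linear_combination (h1 + h2') / 2
  have hd : ((downPart s).card : ℂ) = (downPart t).card := by linear_combination (h1 - h2') / 2
  exact ⟨by exact_mod_cast hu, by exact_mod_cast hd⟩

/-- **`Ŝ₋Ŝ₊` commutes with the `(a, b)`-sector projector** (a diagonal indicator). -/
theorem sectorDiagonal_mul_spinMinus_mul_spinPlus (a b : ℕ) :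
    diagonal (fun s : Finset (Orb (Fin k)) => if (upPart s).card = a ∧ (downPart s).card = b then (1 : ℂ) else 0) *
        (spinMinus * spinPlus : Op k) =
      (spinMinus * spinPlus : Op k) *
        diagonal (fun s : Finset (Orb (Fin k)) => if (upPart s).card = a ∧ (downPart s).card = b then (1 : ℂ) else 0) := by
  refine diagonal_mul_eq_mul_diagonal_of_apply fun s t hst => ?_
  obtain ⟨hu, hd⟩ := upPart_downPart_eq_of_spinMinus_mul_spinPlus_apply_ne_zero hst
  rw [hu, hd]

/-! ## The singlet compression is PSD when `lo ≤ E₀(S = 0)` -/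

/-- For a singlet lower row and ANY matrix `Q` whose range lies in the singlet subspace of the `(n, n)` sector
(`Q x` in the sector and `Ŝ₊ Q = 0`): `Qᴴ (H_F − lo) Q ⪰ 0` (singlet variational principle). -/
theorem posSemidef_singletCompression {F : Model k} (hF : F.IsSymmetric) {n : ℕ} {lo : ℚ}
    (h : SingletLowerRow F n lo) (Q : Op k) (hQsec : ∀ x, IsInSector n n (Q *ᵥ x))
    (hQS : (spinPlus : Op k) * Q = 0) :
    (Qᴴ * (F.hamiltonian - (((lo : ℚ) : ℝ) : ℂ) • (1 : Op k)) * Q).PosSemidef := by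
  set A : Op k := F.hamiltonian - (((lo : ℚ) : ℝ) : ℂ) • (1 : Op k) with hAdef
  have hH : F.hamiltonian.IsHermitian := Model.hamiltonian_isHermitian hF
  have hA : A.IsHermitian := by
    refine hH.sub ?_
    change ((((lo : ℚ) : ℝ) : ℂ) • (1 : Op k))ᴴ = _
    rw [conjTranspose_smul, conjTranspose_one, Complex.star_def, Complex.conj_ofReal]
  refine PosSemidef.of_dotProduct_mulVec_nonneg (isHermitian_conjTranspose_mul_mul Q hA) fun x => ?_
  have hform : star x ⬝ᵥ (Qᴴ * A * Q) *ᵥ x = star (Q *ᵥ x) ⬝ᵥ A *ᵥ (Q *ᵥ x) := by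
    rw [← mulVec_mulVec, ← mulVec_mulVec, dotProduct_mulVec, star_mulVec]
  rw [hform]
  set ψ : Fock (Orb (Fin k)) := Q *ᵥ x with hψdef
  -- `ψ` is a singlet of the `(n, n)` sector
  have hψsec : IsInSector n n ψ := hQsec x
  have hψS : spinPlus *ᵥ ψ = 0 := by
    rw [hψdef, mulVec_mulVec, hQS, zero_mulVec]
  have hψK : ψ ∈ singletSector k n := by
    rw [mem_singletSector_iff]
    exact ⟨(mem_szSector_iff_isInSector n n ψ).2 hψsec, hψS⟩
  -- the singlet variational principle: `lo ‖ψ‖² ≤ Re ⟨ψ, H ψ⟩`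
  have hN : 0 ≤ (star ψ ⬝ᵥ ψ).re := (Complex.nonneg_iff.mp (dotProduct_star_self_nonneg ψ)).1
  have hvar : ((lo : ℚ) : ℝ) * (star ψ ⬝ᵥ ψ).re ≤ (star ψ ⬝ᵥ F.hamiltonian *ᵥ ψ).re := by
    by_cases h0 : ψ = 0
    · rw [h0, dotProduct_zero, mulVec_zero, dotProduct_zero, Complex.zero_re, mul_zero]
    obtain ⟨c, hc, hcc, hc1⟩ := EigenvalueContinuation.exists_normalize h0
    have hle := minEnergyOn_le_rayleigh_of_mem hH (singletSector k n) ((singletSector k n).smul_mem _ hψK) hc1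
    have hE : ((lo : ℚ) : ℝ) ≤ F.hamiltonian.minEnergyOn (singletSector k n) := h.le
    rw [mulVec_smul, EigenvalueContinuation.star_real_smul_dotProduct_real_smul, Complex.re_ofReal_mul] at hle
    have hmul := mul_le_mul_of_nonneg_right (hE.trans hle) hN
    calc ((lo : ℚ) : ℝ) * (star ψ ⬝ᵥ ψ).re
        ≤ c * c * (star ψ ⬝ᵥ F.hamiltonian *ᵥ ψ).re * (star ψ ⬝ᵥ ψ).re := hmul
      _ = (star ψ ⬝ᵥ F.hamiltonian *ᵥ ψ).re * (c * c * (star ψ ⬝ᵥ ψ).re) := by ring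
      _ = (star ψ ⬝ᵥ F.hamiltonian *ᵥ ψ).re := by rw [hcc, mul_one]
  have hq : star ψ ⬝ᵥ A *ᵥ ψ = star ψ ⬝ᵥ F.hamiltonian *ᵥ ψ - (((lo : ℚ) : ℝ) : ℂ) * (star ψ ⬝ᵥ ψ) := by
    rw [hAdef, sub_mulVec, smul_mulVec, one_mulVec, dotProduct_sub, dotProduct_smul, smul_eq_mul]
  have hnorm_im : (star ψ ⬝ᵥ ψ).im = 0 := ((Complex.nonneg_iff.mp (dotProduct_star_self_nonneg ψ)).2).symm
  rw [hq, Complex.nonneg_iff]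
  constructor
  · rw [Complex.sub_re, Complex.re_ofReal_mul, sub_nonneg]
    exact hvar
  · rw [Complex.sub_im, Complex.im_ofReal_mul, hnorm_im, mul_zero, sub_zero, im_star_dotProduct_mulVec_self hH ψ]

/-! ## Completeness -/

/-- **COMPLETENESS OF THE SINGLET LOWER PREDICATE.** Every true singlet lower row of a symmetric model HAS a singlet
lower certificate of the cell's format: `SingletLowerRow F n lo → SingletLowerCertificate F n lo`. Witness: Gram part =
the singlet compression `(PΠ)ᴴ (H_F − lo) (PΠ)` (`Π = 1 − (Ŝ₊P)⁺(Ŝ₊P)`), one multiplier pair per spin-resolved number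
ideal (as in `lowerCertificate_of_lowerRow`), ONE multiplier pair `(PAPZP, PZ(PAP)Π)` of the `Ŝ₋Ŝ₊` ideal
(`Z = ((Ŝ₊P)ᴴ(Ŝ₊P))⁺`), all other families empty, `c = lo`, no residual. -/
theorem singletLowerCertificate_of_singletLowerRow {F : Model k} (hF : F.IsSymmetric) {n : ℕ} {lo : ℚ}
    (h : SingletLowerRow F n lo) : SingletLowerCertificate F n lo := by
  classical
  -- the diagonal data (as in the sector proof, with `a = b = n`)
  set ι := Finset (Orb (Fin k)) with hιdef
  set p : ι → ℂ := fun s => if (upPart s).card = n ∧ (downPart s).card = n then (1 : ℂ) else 0 with hpdef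
  set u : ι → ℂ := fun s => ((upPart s).card : ℂ) - n with hudef
  set v : ι → ℂ := fun s => ((downPart s).card : ℂ) - n with hvdef
  set zu : ι → ℂ := fun s => if (upPart s).card = n then (0 : ℂ) else (((upPart s).card : ℂ) - n)⁻¹ with hzudef
  set w : ι → ℂ := fun s => (if (upPart s).card = n then (1 : ℂ) else 0) *
      (if (downPart s).card = n then (0 : ℂ) else (((downPart s).card : ℂ) - n)⁻¹) with hwdef
  set A : Op k := F.hamiltonian - (((lo : ℚ) : ℝ) : ℂ) • (1 : Op k) with hAdef
  set P : Op k := diagonal p with hPdef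
  set Du : Op k := diagonal u with hDudef
  set Dv : Op k := diagonal v with hDvdef
  set Zu : Op k := diagonal zu with hZudef
  set W : Op k := diagonal w with hWdef
  -- `1 − P = Zu Du + W Dv = Du Zu + Dv W`
  have hkey : ∀ s, zu s * u s + w s * v s = 1 - p s := fun s => pinv_identity n n (upPart s).card (downPart s).card
  have h1 : Zu * Du + W * Dv = 1 - P := by
    rw [hZudef, hDudef, hWdef, hDvdef, hPdef, diagonal_mul_diagonal, diagonal_mul_diagonal, diagonal_add,
      ← diagonal_one, diagonal_sub]
    exact congrArg diagonal (funext hkey)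
  have h2 : Du * Zu + Dv * W = 1 - P := by
    rw [hZudef, hDudef, hWdef, hDvdef, hPdef, diagonal_mul_diagonal, diagonal_mul_diagonal, diagonal_add,
      ← diagonal_one, diagonal_sub]
    exact congrArg diagonal (funext fun s => by rw [mul_comm (u s), mul_comm (v s)]; exact hkey s)
  have hident : A = P * A * P + ((A * Zu * Du + Du * (Zu * A * P)) + (A * W * Dv + Dv * (W * A * P))) := by
    have e1 : (A * Zu * Du + Du * (Zu * A * P)) + (A * W * Dv + Dv * (W * A * P)) =
        A * (Zu * Du + W * Dv) + (Du * Zu + Dv * W) * A * P := by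
      simp only [Matrix.mul_add, Matrix.add_mul, Matrix.mul_assoc]
      abel
    rw [e1, h1, h2]
    simp only [Matrix.mul_sub, Matrix.sub_mul, Matrix.mul_one, Matrix.one_mul]
    abel
  -- `P² = P`, `Pᴴ = P`
  have hp01 : ∀ s, p s * p s = p s := by
    intro s; simp only [hpdef]; split_ifs <;> simp
  have hPP : P * P = P := by
    rw [hPdef, diagonal_mul_diagonal]; exact congrArg diagonal (funext hp01)
  have hpstar : ∀ s, star (p s) = p s := by
    intro s; simp only [hpdef]; split_ifs <;> simp
  have hPh : Pᴴ = P := by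
    rw [hPdef, diagonal_conjTranspose]; exact congrArg diagonal (funext hpstar)
  -- `S = Ŝ₋Ŝ₊`: Hermitian and commuting with `P` (then made opaque)
  set S : Op k := spinMinus * spinPlus with hSdef
  clear_value S
  have hSh : Sᴴ = S := by
    rw [hSdef, conjTranspose_mul]
    change spinPlusᴴ * spinPlusᴴᴴ = spinPlusᴴ * spinPlus
    rw [conjTranspose_conjTranspose]
  have hSP : P * S = S * P := by
    rw [hPdef, hSdef]; exact sectorDiagonal_mul_spinMinus_mul_spinPlus n n
  -- `B = Ŝ₊ P`, `Bᴴ B = P S`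
  set B : Op k := spinPlus * P with hBdef
  clear_value B
  have hBB : Bᴴ * B = P * S := by
    rw [hBdef, conjTranspose_mul, hPh]
    change P * spinMinus * (spinPlus * P) = P * S
    rw [Matrix.mul_assoc, ← Matrix.mul_assoc spinMinus, ← hSdef, ← hSP, ← Matrix.mul_assoc, hPP]
  have hPSh : (P * S).IsHermitian := by
    rw [← hBB]; exact isHermitian_conjTranspose_mul_self B
  -- `Zs = (P S)⁺` (Hermitian), `R = B⁺ B = Zs (P S) = S P Zs`, `Pk = 1 − R` (the projector onto `ker B`)
  set Zs : Op k := pinv (P * S) with hZsdef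
  clear_value Zs
  have hZsh : Zsᴴ = Zs := by
    rw [hZsdef, pinv_eq_pinvOfIsHermitian hPSh]; exact (isHermitian_pinvOfIsHermitian hPSh).eq
  set R : Op k := pinv B * B with hRdef
  clear_value R
  have hRh : Rᴴ = R := by rw [hRdef]; exact (isHermitian_pinv_mul B).eq
  have hRr : R = Zs * (P * S) := by
    rw [hRdef, pinv_mul_self_eq, hBB, ← hZsdef]
  have hRl : R = S * P * Zs := by
    rw [← hRh, hRr, conjTranspose_mul, conjTranspose_mul, hSh, hPh, hZsh]
  have hBPk : B * (1 - R) = 0 := by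
    rw [hRdef, Matrix.mul_sub, Matrix.mul_one, ← Matrix.mul_assoc, mul_pinv_mul_self, sub_self]
  set Pk : Op k := 1 - R with hPkdef
  clear_value Pk
  have hPkh : Pkᴴ = Pk := by rw [hPkdef, conjTranspose_sub, conjTranspose_one, hRh]
  have hPkR : Pk + R = 1 := by rw [hPkdef]; abel
  -- the sector compression `M = P A P` and its split along `Pk + R = 1`
  set M : Op k := P * A * P with hMdef
  clear_value M
  have e3 : M * R = M * Zs * P * S := by rw [hRr]; noncomm_ring
  have e4 : R * (M * Pk) = S * (P * Zs * M * Pk) := by rw [hRl]; noncomm_ring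
  have hsplit : M = Pk * M * Pk + (M * Zs * P * S + S * (P * Zs * M * Pk)) := by
    calc M = M * Pk + M * R := by rw [← Matrix.mul_add, hPkR, Matrix.mul_one]
      _ = (Pk + R) * (M * Pk) + M * R := by rw [hPkR, Matrix.one_mul]
      _ = Pk * (M * Pk) + R * (M * Pk) + M * R := by rw [Matrix.add_mul]
      _ = Pk * M * Pk + (M * Zs * P * S + S * (P * Zs * M * Pk)) := by rw [e4, e3, ← Matrix.mul_assoc]; abel
  -- the Gram part `(P Pk)ᴴ A (P Pk) = Pk M Pk` is PSD
  have hQsec : ∀ x, IsInSector n n ((P * Pk) *ᵥ x) := by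
    intro x s hs
    rw [← mulVec_mulVec, hPdef, mulVec_diagonal, hpdef]
    simp only [hs, if_false, zero_mul]
  have hQS : (spinPlus : Op k) * (P * Pk) = 0 := by
    rw [← Matrix.mul_assoc, ← hBdef]; exact hBPk
  have hPSD : ((P * Pk)ᴴ * A * (P * Pk)).PosSemidef := posSemidef_singletCompression hF h (P * Pk) hQsec hQS
  have hGeq : (P * Pk)ᴴ * A * (P * Pk) = Pk * M * Pk := by
    rw [conjTranspose_mul, hPkh, hPh, hMdef]; noncomm_ring
  rw [hGeq] at hPSD
  -- the whole identity
  have hfinal : A = Pk * M * Pk + ((A * Zu * Du + Du * (Zu * A * P)) + (A * W * Dv + Dv * (W * A * P)) +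
      (M * Zs * P * S + S * (P * Zs * M * Pk))) := by
    calc A = M + ((A * Zu * Du + Du * (Zu * A * P)) + (A * W * Dv + Dv * (W * A * P))) := hident
      _ = Pk * M * Pk + (M * Zs * P * S + S * (P * Zs * M * Pk)) +
            ((A * Zu * Du + Du * (Zu * A * P)) + (A * W * Dv + Dv * (W * A * P))) := by rw [← hsplit]
      _ = _ := by abel
  set e : ι ≃ Fin (Fintype.card ι) := Fintype.equivFin ι with hedef
  refine ⟨Fintype.card ι, 0, 1, 1, 1, 0, 0, 0, (Pk * M * Pk).submatrix e.symm e.symm,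
    (posSemidef_submatrix_equiv e.symm).mpr hPSD, fun i => Matrix.single ∅ (e.symm i) (1 : ℂ),
    Fin.elim0, fun _ => A * Zu, fun _ => Zu * A * P, fun _ => A * W, fun _ => W * A * P,
    fun _ => M * Zs * P, fun _ => P * Zs * M * Pk,
    Fin.elim0, Fin.elim0, fun j => j.elim0, Fin.elim0, Fin.elim0, Fin.elim0, Fin.elim0,
    ((lo : ℚ) : ℝ), by simp, ?_⟩
  rw [gramForm_submatrix_single (Pk * M * Pk) ∅ e, sum_numberOp_up_sub_eq_diagonal n,
    sum_numberOp_down_sub_eq_diagonal n, ← hSdef]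
  simp only [Finset.univ_eq_empty, Finset.sum_empty, Fin.sum_univ_one, zero_add, add_zero]
  exact hfinal

/-- `SingletLowerCertificate ↔ SingletLowerRow` for symmetric models on the physical range: the singlet lower claim
nodes of `Certificates/` are exactly as strong as the rows they carry. -/
theorem singletLowerCertificate_iff_singletLowerRow {F : Model k} (hF : F.IsSymmetric) {n : ℕ} (hn : n ≤ k)
    (lo : ℚ) : SingletLowerCertificate F n lo ↔ SingletLowerRow F n lo :=
  ⟨singletLowerRow_of_certificate hF hn, singletLowerCertificate_of_singletLowerRow hF⟩

end Summit.Ventures.CertifiedQuantumChemistry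

end
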